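import Summits.BirchSwinnertonDyer.BirchSwinnertonDyer.Theorems.QuadraticBranchSignedControlPlusEtaNonsurjThetaFunctionalEquationNormCoordinateMainConjecture
import Summits.BirchSwinnertonDyer.BirchSwinnertonDyer.Theorems.QuadraticBranchSignedControlPlusEtaCMRowsUpToMu
import HarnessLib

/-!
# Route `QuadraticBranchSignedControl` (rung K8, cell `bsd-potss`), residual crux `PlusEtaMainConjectureNonsurj`
# (stmt-BirchSwinnertonDyer-19606): THE FUNCTIONAL EQUATION ON THE QUADRATIC BRANCH, XLIII — THE NORM COORDINATE ON THE CM ROWS: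
# **along an equality of ideals UP TO POWERS OF `p` the Weierstrass polynomial, the order at `T = 0` and the norm polynomial `H ∈ ℤ_p[Z]` are
# SHARED and the two ideals differ by the single integer `μ₁ − μ₂`**; hence, granted Burungale–Tian 2026 Thm. 2.6 ∘ Kobayashi (`h26`) and
# Kobayashi Thm. 2.2 at `η` (`h22`) — and WITHOUT Kim 3.11η — on every CM row of the crux the norm-coordinate invariants `(r₀, k, H)` of
# `Char X⁺(V/K_∞)^η` ARE those of `L_p⁺(V, η, X)`, and Kobayashi's even main conjecture at `η` there is the one equation `μ_alg = μ_an`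
# (seat `bsd-potss-k8eta-c2` g32; kernel; §124 fact-free algebra, §125 conditional on `h26`, `h22` in hypothesis position)

WHY. Parts XXXII–XXXIII read an `ι`-stable divisibility / equality of ideals in the norm coordinate `Z = T + ιT` as statements about three
invariants (`μ`, `r₀ = ord_T`, `H ∈ ℤ_p[Z]`), the ALGEBRAIC norm form being granted by Kim's functional equation (Kim 3.11η, named fact).
On the CM rows — and the census of Parts XXIX–XLII (the 44 level-4 rows of P-29R … P-31G) consists of CM rows ONLY (P-32A, kit j340231) —
the tree already holds more: seat k8q-c2 g3/g4 (`EtaCMUpToMu.charIdeal_upToP_of_cm`, p478350; `…CMLambdaOfBT26`, `…CMRankOneOfBT26`)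
derive from Burungale–Tian's Thm. 2.6 (Kato's main conjecture `⊗ ℚ` for CM newforms, composed with Kobayashi §5/7.1 ii)/7.4) that
`(p^b)·Char X⁺(V/K_∞)^η = (p^a)·(L_p⁺(V,η,X))` for some `a, b`, whence `λ_alg = λ_an` and `ord_T Char = ord_T L_p⁺`. This Part puts that
input through the norm coordinate: §124 (pure `Λ`-algebra) an equality `(p^b)·(g) = (p^a)·(L)` between elements with Weierstrass data
forces `P_g = P_L`, `μ_g + b = μ_L + a`, equal orders and — for norm forms — equal norm polynomials `H_g = H_L`, and then
`(g) = (L) ⟺ μ_g = μ_L`, `(L) ⊆ (g) ⟺ μ_g ≤ μ_L`, `(g) ⊆ (L) ⟺ μ_L ≤ μ_g`; §125 on the crux's objects: for a CM `V` the algebraic norm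
form EXISTS and EQUALS the analytic one (Part XXXIII's `exists_normForm_pair_plus_of_kim` with `hKim` REPLACED by `h26 ∧ h22 ∧ V.HasCM`),
so the displayed `(r₀, k, H mod 5^m)` of the census tables are at once the invariants of `Char X⁺(V/K_∞)^η`, the column «`H_alg ∈ {1, H_an}`
under Kato» of P-31G is superseded there by «`H_alg = H_an`», and (C1⁺_η) at every CM datum is `μ_alg = μ_an` — the three readings of
Part XXXIII §98 with the `r₀`- and `H`-clauses DISCHARGED.

WHAT (kernel; §124 fact-free, §125 CONDITIONAL on the named facts `h26`, `h22` in hypothesis position; nothing else assumed).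
§124 `weierstrass_eq_of_upToP`, `order_toNat_eq_of_upToP`, **`normForm_of_upToP`** (shared `r₀`, `H`, `P`; `μ_g + b = μ_L + a`; the three
`μ`-readings). §125 **`exists_normForm_pair_plus_of_bt26_of_cm`** (the CM twin of XXXIII §99, Kim-free), **`normPoly_alg_eq_an_of_bt26_of_cm`**
(any algebraic norm form has the analytic `r₀` and `H`), `plusEtaMC_iff_mu_eq_of_bt26_of_cm` (the main conjecture at a CM datum ⟺ `m_g = m_L`
for ANY Weierstrass data of a generator and of `Lη`).

HONEST FRAMING (cell `bsd-potss`; FULL-BSD rank ≤ 1 programme, HUMAN RULING D-0036/D-0074): THEOREMS ONLY — no definition, no named fact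
minted, no `sorry`, axioms standard. §125 is CONDITIONAL on `BurungaleTian2026.thm26_etaKatoSequences_charIdeal_upToP_of_cm` (`h26`) and
`Kobayashi2003.thm22_etaSignedSelmerDual_finite_torsion` (`h22`), published theorems NOT proved in the tree. The `μ`-part (`m_g = m_L`) is
NOT proved for any row here (it is Burungale–Tian's Rem. 2.7; on the CM rank-`0` rows it is k8q-c2 g3's p478801, on the CM rank-`1` rows it is
`BSD_p(W)`-complete by k8q-c2 g4); crux 19606, its CM stubs and skeleton v7 are unchanged; nothing is booked; `BSD(W,p)` is claimed for no
pair. `--supports stmt-BirchSwinnertonDyer-19606`.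

References: [BurungaleTian2026] Thm. 2.6 and Rem. 2.7 (p. 5); [Kobayashi2003] §4 Even main conjecture, Thm. 4.1 (p. 8), Thm. 2.2 (p. 5),
Thm. 3.2 with (3.4)/(3.6) (p. 7), proof of Thm. 7.4 (p. 13); [Washington1997] §7.1 (Thm. 7.3), §13.2; [GreenbergVatsal2000] p. 4 (after Thm. (1.2));
[MazurTateTeitelbaum1986Invent] §I.17; [PollackRubin2004] Theorem and remark p. 448.
-/

set_option linter.dupNamespace false

noncomputable section

open scoped Classical MatrixGroups ModularForm Topology

open PowerSeries CongruenceSubgroup WeierstrassCurve Field Literature.NumberTheory.EllipticCurves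
  Literature.NumberTheory.EllipticCurves.ModularForms Literature.NumberTheory.GaloisRepresentations ZpExtension
open Literature.NumberTheory.EllipticCurves.IwasawaAlgebra
open Summit.BirchSwinnertonDyer.Rank1Residual.Additive

namespace Summit.BirchSwinnertonDyer.BirchSwinnertonDyer.Theorems.EtaThetaFunctionalEquation

variable {p : ℕ} [hp : Fact p.Prime] {r : ℤ_[p]} {S Z : IwasawaAlgebra p}

/-! ## §124 Weierstrass data and norm forms along `(p^b)·(g) = (p^a)·(L)` -/

section UpToP

variable {g L : IwasawaAlgebra p} {mg mL : ℕ} {Pg PL Hg HL : Polynomial ℤ_[p]} {Ug UL : IwasawaAlgebra p} {a b : ℕ}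

/-- `(p^b)·(g) = (p^a)·(L)` as an equality of principal ideals: `(C(p^b)·g) = (C(p^a)·L)`. [folklore] -/
theorem span_C_pow_mul_eq_of_upToP
    (hab : Ideal.span {((p : IwasawaAlgebra p) ^ b)} * Ideal.span {g} = Ideal.span {((p : IwasawaAlgebra p) ^ a)} * Ideal.span {L}) :
    Ideal.span {C ((p : ℤ_[p]) ^ b) * g} = Ideal.span {C ((p : ℤ_[p]) ^ a) * L} := by
  rw [Ideal.span_singleton_mul_span_singleton, Ideal.span_singleton_mul_span_singleton, natCast_pow_eq_C_pow, natCast_pow_eq_C_pow] at hab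
  exact hab

/-- The Weierstrass datum of `C(pⁿ)·f`: `f = p^m·P·U` ⟹ `C(pⁿ)·f = p^{m+n}·P·U`. [cite: Washington1997, §7.1 (Thm. 7.3)] -/
theorem C_pow_mul_weierstrass {f : IwasawaAlgebra p} {m : ℕ} {P : Polynomial ℤ_[p]} {U : IwasawaAlgebra p}
    (hf : f = C ((p : ℤ_[p]) ^ m) * (P : IwasawaAlgebra p) * U) (n : ℕ) :
    C ((p : ℤ_[p]) ^ n) * f = C ((p : ℤ_[p]) ^ (m + n)) * (P : IwasawaAlgebra p) * U := by
  rw [hf, pow_add, map_mul]; ring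

/-- **THE WEIERSTRASS POLYNOMIAL IS SHARED ALONG AN EQUALITY UP TO POWERS OF `p`.** If `(p^b)·(g) = (p^a)·(L)` for `g = p^{m_g}P_gU_g`,
`L = p^{m_L}P_LU_L` (Weierstrass data: `P` distinguished, `U ∈ Λˣ`), then **`m_g + b = m_L + a` and `P_g = P_L`** (uniqueness of Weierstrass
preparation for the element `C(p^b)g ~ C(p^a)L`). The shape of Burungale–Tian's Thm. 2.6 read on `Char X⁺(V/K_∞)^η` versus `(L_p⁺(V,η,X))`.
[cite: Washington1997, §7.1 (Thm. 7.3)] [cite: BurungaleTian2026, Thm. 2.6 (p. 5); shape only] -/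
theorem weierstrass_eq_of_upToP
    (hPg : Pg.IsDistinguishedAt (IsLocalRing.maximalIdeal ℤ_[p])) (hPL : PL.IsDistinguishedAt (IsLocalRing.maximalIdeal ℤ_[p]))
    (hUg : IsUnit Ug) (hUL : IsUnit UL)
    (hgW : g = C ((p : ℤ_[p]) ^ mg) * (Pg : IwasawaAlgebra p) * Ug) (hLW : L = C ((p : ℤ_[p]) ^ mL) * (PL : IwasawaAlgebra p) * UL)
    (hab : Ideal.span {((p : IwasawaAlgebra p) ^ b)} * Ideal.span {g} = Ideal.span {((p : IwasawaAlgebra p) ^ a)} * Ideal.span {L}) :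
    mg + b = mL + a ∧ Pg = PL :=
  weierstrass_eq_of_span_eq hPg hPL hUg hUL (C_pow_mul_weierstrass hgW b) (C_pow_mul_weierstrass hLW a) (span_C_pow_mul_eq_of_upToP hab)

/-- **THE ORDER AT `T = 0` IS SHARED** along `(p^b)·(g) = (p^a)·(L)` (same data): `ord_T g = ord_T P_g = ord_T P_L = ord_T L`.
[cite: Washington1997, §7.1 (Thm. 7.3)] -/
theorem order_eq_of_upToP'
    (hPg : Pg.IsDistinguishedAt (IsLocalRing.maximalIdeal ℤ_[p])) (hPL : PL.IsDistinguishedAt (IsLocalRing.maximalIdeal ℤ_[p]))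
    (hUg : IsUnit Ug) (hUL : IsUnit UL)
    (hgW : g = C ((p : ℤ_[p]) ^ mg) * (Pg : IwasawaAlgebra p) * Ug) (hLW : L = C ((p : ℤ_[p]) ^ mL) * (PL : IwasawaAlgebra p) * UL)
    (hab : Ideal.span {((p : IwasawaAlgebra p) ^ b)} * Ideal.span {g} = Ideal.span {((p : IwasawaAlgebra p) ^ a)} * Ideal.span {L}) :
    PowerSeries.order g = PowerSeries.order L := by
  rw [order_of_weierstrass hUg hgW, order_of_weierstrass hUL hLW, (weierstrass_eq_of_upToP hPg hPL hUg hUL hgW hLW hab).2]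

/-- **NORM FORMS ALONG `(p^b)·(g) = (p^a)·(L)`: `m_g + b = m_L + a`, `r_g = r_L`, `H_g = H_L`, `P_g = P_L`, and the three `μ`-readings
`(g) = (L) ⟺ m_g = m_L`, `(L) ⊆ (g) ⟺ m_g ≤ m_L`, `(g) ⊆ (L) ⟺ m_L ≤ m_g`.** Here `p` is odd (`2r = −1`, `S = T(1+T)^r`, `Z = T + ιT`),
`g = p^{m_g}P_gU_g`, `L = p^{m_L}P_LU_L` are Weierstrass data and `P_g = T^{ord g}(1+T)^{k_g}H_g(Z)`, `P_L = T^{ord L}(1+T)^{k_L}H_L(Z)` norm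
forms (`H` distinguished). So once an up-to-`p` equality is known, the Kato reading, the Eisenstein reading and the main-conjecture reading
of Part XXXIII §98 all collapse to inequalities / an equality between the two `μ`-invariants.
[cite: Washington1997, §7.1 (Thm. 7.3), §13.2] [cite: GreenbergVatsal2000, p. 4 (after Thm. (1.2))] [cite: BurungaleTian2026, Thm. 2.6 and Rem. 2.7 (p. 5); shape only] -/
theorem normForm_of_upToP (hr : 2 * r = -1) (hS : S = X * binomialSeries ℤ_[p] r) (hZ : Z = X + invol p X)
    (hPg : Pg.IsDistinguishedAt (IsLocalRing.maximalIdeal ℤ_[p])) (hPL : PL.IsDistinguishedAt (IsLocalRing.maximalIdeal ℤ_[p]))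
    (hUg : IsUnit Ug) (hUL : IsUnit UL)
    (hgW : g = C ((p : ℤ_[p]) ^ mg) * (Pg : IwasawaAlgebra p) * Ug) (hLW : L = C ((p : ℤ_[p]) ^ mL) * (PL : IwasawaAlgebra p) * UL)
    (hHg : Hg.IsDistinguishedAt (IsLocalRing.maximalIdeal ℤ_[p])) (hHL : HL.IsDistinguishedAt (IsLocalRing.maximalIdeal ℤ_[p]))
    (hPHg : (Pg : IwasawaAlgebra p) = X ^ (PowerSeries.order g).toNat * (1 + X) ^ Hg.natDegree * PowerSeries.subst Z (Hg : IwasawaAlgebra p))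
    (hPHL : (PL : IwasawaAlgebra p) = X ^ (PowerSeries.order L).toNat * (1 + X) ^ HL.natDegree * PowerSeries.subst Z (HL : IwasawaAlgebra p))
    (hab : Ideal.span {((p : IwasawaAlgebra p) ^ b)} * Ideal.span {g} = Ideal.span {((p : IwasawaAlgebra p) ^ a)} * Ideal.span {L}) :
    mg + b = mL + a ∧ (PowerSeries.order g).toNat = (PowerSeries.order L).toNat ∧ Hg = HL ∧ Pg = PL ∧
      (Ideal.span {g} = Ideal.span {L} ↔ mg = mL) ∧ (Ideal.span {L} ≤ Ideal.span {g} ↔ mg ≤ mL) ∧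
      (Ideal.span {g} ≤ Ideal.span {L} ↔ mL ≤ mg) := by
  obtain ⟨hm, hP⟩ := weierstrass_eq_of_upToP hPg hPL hUg hUL hgW hLW hab
  have hord : PowerSeries.order g = PowerSeries.order L := order_eq_of_upToP' hPg hPL hUg hUL hgW hLW hab
  have hordN : (PowerSeries.order g).toNat = (PowerSeries.order L).toNat := by rw [hord]
  -- the scaled data `C(p^b)g`, `C(p^a)L` generate the same ideal; their norm forms have the orders of `g`, `L`
  have h1 := C_pow_mul_weierstrass hgW b
  have h2 := C_pow_mul_weierstrass hLW a
  have hord1 : PowerSeries.order (C ((p : ℤ_[p]) ^ b) * g) = PowerSeries.order g := by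
    rw [order_of_weierstrass hUg h1, order_of_weierstrass hUg hgW]
  have hord2 : PowerSeries.order (C ((p : ℤ_[p]) ^ a) * L) = PowerSeries.order L := by
    rw [order_of_weierstrass hUL h2, order_of_weierstrass hUL hLW]
  have hPHg' : (Pg : IwasawaAlgebra p) =
      X ^ (PowerSeries.order (C ((p : ℤ_[p]) ^ b) * g)).toNat * (1 + X) ^ Hg.natDegree * PowerSeries.subst Z (Hg : IwasawaAlgebra p) := by
    rw [hord1]; exact hPHg
  have hPHL' : (PL : IwasawaAlgebra p) =
      X ^ (PowerSeries.order (C ((p : ℤ_[p]) ^ a) * L)).toNat * (1 + X) ^ HL.natDegree * PowerSeries.subst Z (HL : IwasawaAlgebra p) := by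
    rw [hord2]; exact hPHL
  obtain ⟨-, -, hH⟩ := (normForm_span_eq_iff hr hS hZ hPg hPL hUg hUL h1 h2 hHg hHL hPHg' hPHL').mp (span_C_pow_mul_eq_of_upToP hab)
  refine ⟨hm, hordN, hH, hP, ?_, ?_, ?_⟩
  · rw [normForm_span_eq_iff hr hS hZ hPg hPL hUg hUL hgW hLW hHg hHL hPHg hPHL]
    exact ⟨fun h ↦ h.1, fun h ↦ ⟨h, hordN, hH⟩⟩
  · rw [Ideal.span_singleton_le_span_singleton, normForm_dvd_iff hr hS hZ hPg hPL hUg hUL hgW hLW hHg hHL hPHg hPHL]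
    exact ⟨fun h ↦ h.1, fun h ↦ ⟨h, hordN.le, hH ▸ dvd_rfl⟩⟩
  · rw [Ideal.span_singleton_le_span_singleton, normForm_dvd_iff hr hS hZ hPL hPg hUL hUg hLW hgW hHL hHg hPHL hPHg]
    exact ⟨fun h ↦ h.1, fun h ↦ ⟨h, hordN.ge, hH ▸ dvd_rfl⟩⟩

end UpToP

/-! ## §125 On the crux's objects, CM rows: the norm-coordinate invariants of `Char X⁺(V/K_∞)^η` are those of `L_p⁺(V, η, X)` (Kim-free) -/

section Crux

variable {N : ℕ} [NeZero N] {f : CuspForm (Gamma0 N) 2}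
  {K₀ : Type} [Field K₀] [NumberField K₀] [IsCyclotomicExtension {p} ℚ K₀] [(galRange (K := ℚ) K₀).Normal]
  {ηq : absoluteGaloisGroup ℚ →* ℤˣ} {V : WeierstrassCurve ℚ} [V.IsElliptic] [V.IsGloballyMinimal]
  {κ : ZpExtension ℚ p} {γ : absoluteGaloisGroup ℚ}

/-- **THE `η`-MAIN CONJECTURE AT A CM ROW IN THE NORM COORDINATE — Kim-free.** Frame = the node's (`QuadraticBranchPlusEtaMainConjectureAt V p`):
`V` CM, globally minimal, good at `p ≥ 5` with `a_p(V) = 0`, `f` its newform, `ϖ` the period ratio of the parity of `η`, `ηq` THE quadratic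
character of `Gal(K₀/ℚ)` (`K₀ = ℚ(μ_p)`), `κ` cyclotomic with generator `γ ∈ Gal(ℚ̄/K₀)` matching the variable, `D` ANY dual datum of
`Sel⁺(V/K_∞)^η`, `g` ANY nonzero generator of `Char(D.X)` with ANY Weierstrass datum `g = p^{m_g}P_gU_g`, `Lη` ANY nonzero `L_p⁺(V, η, X)` with ANY
Weierstrass datum `Lη = p^{m_L}P_LU_L`; `2r = −1`, `S`, `Z = T + ιT`. THEN (granted `h26`, `h22`) there is ONE distinguished `H ∈ ℤ_p[Z]` with
**`P_g = T^{ord g}(1+T)^{deg H}H(Z)`, `P_L = T^{ord Lη}(1+T)^{deg H}H(Z)`, `ord g = ord Lη`, `P_g = P_L`**, integers `a, b` with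
**`m_g + b = m_L + a` and `(p^b)·Char(D.X) = (p^a)·(Lη)`**, and **`Char(D.X) = (Lη) ⟺ m_g = m_L`, `(Lη) ⊆ Char(D.X) ⟺ m_g ≤ m_L`,
`Char(D.X) ⊆ (Lη) ⟺ m_L ≤ m_g`**. This is Part XXXIII's `exists_normForm_pair_plus_of_kim` on the CM rows with Kim 3.11η REMOVED and its
`r₀`- and `H`-clauses DISCHARGED (Burungale–Tian Thm. 2.6 ∘ Kobayashi §5/7.1 ii)/7.4 via `EtaCMUpToMu.charIdeal_upToP_of_cm`; the analytic norm
form is Part XXVI, fact-free). CONDITIONAL on `h26`, `h22`; nothing booked; the `μ`-clause is proved for no row here.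
[cite: BurungaleTian2026, Thm. 2.6 and Rem. 2.7 (p. 5)] [cite: Kobayashi2003, §4 Even main conjecture, Thm. 4.1 (p. 8), Thm. 2.2 (p. 5), Thm. 3.2 (p. 7)]
[cite: Washington1997, §7.1 (Thm. 7.3), §13.2] [cite: GreenbergVatsal2000, p. 4 (after Thm. (1.2))] -/
theorem exists_normForm_pair_plus_of_bt26_of_cm
    (h26 : BurungaleTian2026.thm26_etaKatoSequences_charIdeal_upToP_of_cm)
    (h22 : Kobayashi2003.thm22_etaSignedSelmerDual_finite_torsion) (hCM : V.HasCM)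
    (hηK : ∀ σ ∈ galRange (K := ℚ) K₀, ηq σ = 1) (hη1 : ηq ≠ 1) (hp5 : 5 ≤ p) (hgood : V.HasGoodReductionAtPrime p)
    (hap : V.frobeniusTrace p = 0) (hf : IsNewformOf V f) (ϖ : ℚ)
    (hϖ : if Even (p / 2) then (ϖ : ℝ) * V.realPeriodRat = plusPeriod f else (ϖ : ℝ) * V.imaginaryPeriodRat = minusPeriod f)
    {Lη : IwasawaAlgebra p} (hL : IsQuadraticBranchPlusLFunction f p ϖ Lη) (hL0 : Lη ≠ 0)
    (hκ : κ.IsCyclotomic) (hγ : κ.IsTopGenerator γ) (hγK : γ ∈ galRange (K := ℚ) K₀) (hγc : IsCyclotomicVariable p γ)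
    (D : EtaSignedSelmerDualData V κ K₀ ℚ_[p] ηq γ 1) {g : IwasawaAlgebra p} (hg : D.charIdeal = Ideal.span {g})
    {mg : ℕ} {Pg : Polynomial ℤ_[p]} (hPg : Pg.IsDistinguishedAt (IsLocalRing.maximalIdeal ℤ_[p])) {Ug : IwasawaAlgebra p} (hUg : IsUnit Ug)
    (hgW : g = C ((p : ℤ_[p]) ^ mg) * (Pg : IwasawaAlgebra p) * Ug)
    {mL : ℕ} {PL : Polynomial ℤ_[p]} (hPL : PL.IsDistinguishedAt (IsLocalRing.maximalIdeal ℤ_[p])) {UL : IwasawaAlgebra p} (hUL : IsUnit UL)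
    (hLW : Lη = C ((p : ℤ_[p]) ^ mL) * (PL : IwasawaAlgebra p) * UL)
    (hr : 2 * r = -1) (hS : S = X * binomialSeries ℤ_[p] r) (hZ : Z = X + invol p X) :
    ∃ H : Polynomial ℤ_[p], H.IsDistinguishedAt (IsLocalRing.maximalIdeal ℤ_[p]) ∧
      (Pg : IwasawaAlgebra p) = X ^ (PowerSeries.order g).toNat * (1 + X) ^ H.natDegree * PowerSeries.subst Z (H : IwasawaAlgebra p) ∧
      (PL : IwasawaAlgebra p) = X ^ (PowerSeries.order Lη).toNat * (1 + X) ^ H.natDegree * PowerSeries.subst Z (H : IwasawaAlgebra p) ∧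
      (PowerSeries.order g).toNat = (PowerSeries.order Lη).toNat ∧ Pg = PL ∧
      (∃ a b : ℕ, mg + b = mL + a ∧
        Ideal.span {((p : IwasawaAlgebra p) ^ b)} * D.charIdeal = Ideal.span {((p : IwasawaAlgebra p) ^ a)} * Ideal.span {Lη}) ∧
      (D.charIdeal = Ideal.span {Lη} ↔ mg = mL) ∧ (Ideal.span {Lη} ≤ D.charIdeal ↔ mg ≤ mL) ∧ (D.charIdeal ≤ Ideal.span {Lη} ↔ mL ≤ mg) := by
  have hp2 : p ≠ 2 := by omega
  -- Burungale–Tian Thm. 2.6 ∘ Kobayashi, on the node's data: `(p^b)·Char = (p^a)·(Lη)`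
  obtain ⟨a, b, hab⟩ :=
    EtaCMUpToMu.charIdeal_upToP_of_cm h26 h22 hCM hηK hη1 hp2 hgood hap hf ϖ hϖ Lη hL hκ hγ hγK hγc D
  have hab' : Ideal.span {((p : IwasawaAlgebra p) ^ b)} * Ideal.span {g} =
      Ideal.span {((p : IwasawaAlgebra p) ^ a)} * Ideal.span {Lη} := by rw [← hg]; exact hab
  -- the analytic norm form (Part XXVI, fact-free)
  obtain ⟨H, hH, hPHL, -⟩ := exists_normForm_plus_row hp5 V hgood hap hf hr hS hZ hL hL0 hPL hUL hLW
  -- the Weierstrass polynomial and the order are shared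
  obtain ⟨hm, hP⟩ := weierstrass_eq_of_upToP hPg hPL hUg hUL hgW hLW hab'
  have hord : PowerSeries.order g = PowerSeries.order Lη := order_eq_of_upToP' hPg hPL hUg hUL hgW hLW hab'
  have hordN : (PowerSeries.order g).toNat = (PowerSeries.order Lη).toNat := by rw [hord]
  have hPHg : (Pg : IwasawaAlgebra p) =
      X ^ (PowerSeries.order g).toNat * (1 + X) ^ H.natDegree * PowerSeries.subst Z (H : IwasawaAlgebra p) := by
    rw [hP, hordN]; exact hPHL
  obtain ⟨-, -, -, -, hiff, hup, hlow⟩ := normForm_of_upToP hr hS hZ hPg hPL hUg hUL hgW hLW hH hH hPHg hPHL hab'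
  refine ⟨H, hH, hPHg, hPHL, hordN, hP, ⟨a, b, hm, hab⟩, ?_, ?_, ?_⟩
  · rw [hg]; exact hiff
  · rw [hg]; exact hup
  · rw [hg]; exact hlow

/-- **ANY algebraic norm form has the analytic invariants: `r₀(g) = r₀(Lη)` and `H_alg = H_an`** (same frame, CM, granted `h26`, `h22`): if a
generator `g` of `Char X⁺(V/K_∞)^η` and `Lη = L_p⁺(V,η,X)` are given with Weierstrass data AND norm forms `P_g = T^{ord g}(1+T)^{k_alg}H_alg(Z)`,
`P_L = T^{ord Lη}(1+T)^{k_an}H_an(Z)` (`H` distinguished; the algebraic one exists e.g. by Kim 3.11η, or by the previous theorem), then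
`m_g + b = m_L + a` for the Burungale–Tian exponents, **`ord g = ord Lη`, `H_alg = H_an`, `P_g = P_L`**, and `Char = (Lη) ⟺ m_g = m_L`.
So on the CM rows the displayed census invariants `(r₀, k, H)` of `L_5⁺(V, η, X)` (Parts XXIX–XLII) are the invariants of the Selmer side,
and «`H_alg ∈ {1, H_an}`» (Part XXXIV, Kato reading) sharpens to `H_alg = H_an` there. CONDITIONAL on `h26`, `h22`; nothing booked.
[cite: BurungaleTian2026, Thm. 2.6 (p. 5)] [cite: Kobayashi2003, §4 Even main conjecture (p. 8), Thm. 2.2 (p. 5)] [cite: Washington1997, §7.1 (Thm. 7.3), §13.2] -/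
theorem normPoly_alg_eq_an_of_bt26_of_cm
    (h26 : BurungaleTian2026.thm26_etaKatoSequences_charIdeal_upToP_of_cm)
    (h22 : Kobayashi2003.thm22_etaSignedSelmerDual_finite_torsion) (hCM : V.HasCM)
    (hηK : ∀ σ ∈ galRange (K := ℚ) K₀, ηq σ = 1) (hη1 : ηq ≠ 1) (hp5 : 5 ≤ p) (hgood : V.HasGoodReductionAtPrime p)
    (hap : V.frobeniusTrace p = 0) (hf : IsNewformOf V f) (ϖ : ℚ)
    (hϖ : if Even (p / 2) then (ϖ : ℝ) * V.realPeriodRat = plusPeriod f else (ϖ : ℝ) * V.imaginaryPeriodRat = minusPeriod f)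
    {Lη : IwasawaAlgebra p} (hL : IsQuadraticBranchPlusLFunction f p ϖ Lη)
    (hκ : κ.IsCyclotomic) (hγ : κ.IsTopGenerator γ) (hγK : γ ∈ galRange (K := ℚ) K₀) (hγc : IsCyclotomicVariable p γ)
    (D : EtaSignedSelmerDualData V κ K₀ ℚ_[p] ηq γ 1) {g : IwasawaAlgebra p} (hg : D.charIdeal = Ideal.span {g})
    {mg : ℕ} {Pg : Polynomial ℤ_[p]} (hPg : Pg.IsDistinguishedAt (IsLocalRing.maximalIdeal ℤ_[p])) {Ug : IwasawaAlgebra p} (hUg : IsUnit Ug)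
    (hgW : g = C ((p : ℤ_[p]) ^ mg) * (Pg : IwasawaAlgebra p) * Ug)
    {mL : ℕ} {PL : Polynomial ℤ_[p]} (hPL : PL.IsDistinguishedAt (IsLocalRing.maximalIdeal ℤ_[p])) {UL : IwasawaAlgebra p} (hUL : IsUnit UL)
    (hLW : Lη = C ((p : ℤ_[p]) ^ mL) * (PL : IwasawaAlgebra p) * UL)
    {Hg HL : Polynomial ℤ_[p]} (hHg : Hg.IsDistinguishedAt (IsLocalRing.maximalIdeal ℤ_[p])) (hHL : HL.IsDistinguishedAt (IsLocalRing.maximalIdeal ℤ_[p]))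
    (hr : 2 * r = -1) (hS : S = X * binomialSeries ℤ_[p] r) (hZ : Z = X + invol p X)
    (hPHg : (Pg : IwasawaAlgebra p) = X ^ (PowerSeries.order g).toNat * (1 + X) ^ Hg.natDegree * PowerSeries.subst Z (Hg : IwasawaAlgebra p))
    (hPHL : (PL : IwasawaAlgebra p) = X ^ (PowerSeries.order Lη).toNat * (1 + X) ^ HL.natDegree * PowerSeries.subst Z (HL : IwasawaAlgebra p)) :
    (∃ a b : ℕ, mg + b = mL + a ∧
        Ideal.span {((p : IwasawaAlgebra p) ^ b)} * D.charIdeal = Ideal.span {((p : IwasawaAlgebra p) ^ a)} * Ideal.span {Lη}) ∧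
      (PowerSeries.order g).toNat = (PowerSeries.order Lη).toNat ∧ Hg = HL ∧ Pg = PL ∧ (D.charIdeal = Ideal.span {Lη} ↔ mg = mL) := by
  have hp2 : p ≠ 2 := by omega
  obtain ⟨a, b, hab⟩ :=
    EtaCMUpToMu.charIdeal_upToP_of_cm h26 h22 hCM hηK hη1 hp2 hgood hap hf ϖ hϖ Lη hL hκ hγ hγK hγc D
  have hab' : Ideal.span {((p : IwasawaAlgebra p) ^ b)} * Ideal.span {g} =
      Ideal.span {((p : IwasawaAlgebra p) ^ a)} * Ideal.span {Lη} := by rw [← hg]; exact hab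
  obtain ⟨hm, hordN, hH, hP, hiff, -, -⟩ := normForm_of_upToP hr hS hZ hPg hPL hUg hUL hgW hLW hHg hHL hPHg hPHL hab'
  refine ⟨⟨a, b, hm, hab⟩, hordN, hH, hP, ?_⟩
  rw [hg]; exact hiff

/-- **(C1⁺_η) AT A CM DATUM IS ONE INTEGER.** Same frame (CM, `h26`, `h22`): for ANY Weierstrass data of a generator `g` of `Char X⁺(V/K_∞)^η`
and of `Lη = L_p⁺(V,η,X) ≠ 0`, Kobayashi's even main conjecture at the datum — `Char(D.X) = (Lη)` — holds **iff `m_g = m_L`**; the Kato-side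
INTEGRAL inclusion `(Lη) ⊆ Char` holds iff `m_g ≤ m_L`, the Eisenstein inclusion iff `m_L ≤ m_g`. (No norm-form hypothesis: the polynomial
parts agree by `weierstrass_eq_of_upToP`.) The `μ`-criterion of `EtaCMUpToMu.charIdeal_eq_iff_muInvariant_eq_of_cm` in Weierstrass-datum
currency. CONDITIONAL on `h26`, `h22`; nothing booked. [cite: BurungaleTian2026, Thm. 2.6 and Rem. 2.7 (p. 5)]
[cite: Kobayashi2003, §4 Even main conjecture, Thm. 4.1 (p. 8)] [cite: Washington1997, §7.1 (Thm. 7.3)] -/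
theorem plusEtaMC_iff_mu_eq_of_bt26_of_cm
    (h26 : BurungaleTian2026.thm26_etaKatoSequences_charIdeal_upToP_of_cm)
    (h22 : Kobayashi2003.thm22_etaSignedSelmerDual_finite_torsion) (hCM : V.HasCM)
    (hηK : ∀ σ ∈ galRange (K := ℚ) K₀, ηq σ = 1) (hη1 : ηq ≠ 1) (hp5 : 5 ≤ p) (hgood : V.HasGoodReductionAtPrime p)
    (hap : V.frobeniusTrace p = 0) (hf : IsNewformOf V f) (ϖ : ℚ)
    (hϖ : if Even (p / 2) then (ϖ : ℝ) * V.realPeriodRat = plusPeriod f else (ϖ : ℝ) * V.imaginaryPeriodRat = minusPeriod f)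
    {Lη : IwasawaAlgebra p} (hL : IsQuadraticBranchPlusLFunction f p ϖ Lη)
    (hκ : κ.IsCyclotomic) (hγ : κ.IsTopGenerator γ) (hγK : γ ∈ galRange (K := ℚ) K₀) (hγc : IsCyclotomicVariable p γ)
    (D : EtaSignedSelmerDualData V κ K₀ ℚ_[p] ηq γ 1) {g : IwasawaAlgebra p} (hg : D.charIdeal = Ideal.span {g})
    {mg : ℕ} {Pg : Polynomial ℤ_[p]} (hPg : Pg.IsDistinguishedAt (IsLocalRing.maximalIdeal ℤ_[p])) {Ug : IwasawaAlgebra p} (hUg : IsUnit Ug)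
    (hgW : g = C ((p : ℤ_[p]) ^ mg) * (Pg : IwasawaAlgebra p) * Ug)
    {mL : ℕ} {PL : Polynomial ℤ_[p]} (hPL : PL.IsDistinguishedAt (IsLocalRing.maximalIdeal ℤ_[p])) {UL : IwasawaAlgebra p} (hUL : IsUnit UL)
    (hLW : Lη = C ((p : ℤ_[p]) ^ mL) * (PL : IwasawaAlgebra p) * UL) :
    (D.charIdeal = Ideal.span {Lη} ↔ mg = mL) ∧ (Ideal.span {Lη} ≤ D.charIdeal ↔ mg ≤ mL) ∧ (D.charIdeal ≤ Ideal.span {Lη} ↔ mL ≤ mg) := by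
  have hp2 : p ≠ 2 := by omega
  obtain ⟨a, b, hab⟩ :=
    EtaCMUpToMu.charIdeal_upToP_of_cm h26 h22 hCM hηK hη1 hp2 hgood hap hf ϖ hϖ Lη hL hκ hγ hγK hγc D
  have hab' : Ideal.span {((p : IwasawaAlgebra p) ^ b)} * Ideal.span {g} =
      Ideal.span {((p : IwasawaAlgebra p) ^ a)} * Ideal.span {Lη} := by rw [← hg]; exact hab
  obtain ⟨hm, hP⟩ := weierstrass_eq_of_upToP hPg hPL hUg hUL hgW hLW hab'
  rw [hg, weierstrass_span_eq_iff hPg hPL hUg hUL hgW hLW, Ideal.span_singleton_le_span_singleton, Ideal.span_singleton_le_span_singleton,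
    weierstrass_dvd_iff hPg hPL hUg hUL hgW hLW, weierstrass_dvd_iff hPL hPg hUL hUg hLW hgW]
  exact ⟨⟨fun h ↦ h.1, fun h ↦ ⟨h, hP⟩⟩, ⟨fun h ↦ h.1, fun h ↦ ⟨h, hP ▸ dvd_rfl⟩⟩, ⟨fun h ↦ h.1, fun h ↦ ⟨h, hP ▸ dvd_rfl⟩⟩⟩

end Crux

end Summit.BirchSwinnertonDyer.BirchSwinnertonDyer.Theorems.EtaThetaFunctionalEquation

end
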